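import Mathlib
import HarnessLib

/-!
# Spiral (O(3)-twisted) self-similar profiles: pointwise algebra of the limit passage
# (crux `EulerZoomLiouville.PowerGaugeEulerLiouville` = stmt-NavierStokesRegularity-19832; line `relative_equilibria`, brick R3a-P7, tools)

Route `EulerZoomLiouville` (NavierStokesRegularity); width seat ns-ezl-w3 g9, LEAD 19832 ns-typeII-p2 g17 KEY «R3a-P7».  The three purely
algebraic identities/bounds for the S-extra terms of the spiral local energy equality (`…SpiralProfileEnergyFixedN`, `…SpiralProfileEnergyEquality`):
`spiralExtra_sub` (the extras minus their limit are linear in `w − v`), `abs_spiralExtra_sub_le` (their bound, in the free `a₅/a₆/a₇` slots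
of `ProfileEnergy.eLpNorm_weight_le`), `integrandS_split` (`(Iₙ + Jₙ) − (I_∞ + J_∞) = (Iₙ − I_∞) + (Jₙ − J_∞)`).
WHAT THIS IS NOT: not NS, not E — bookkeeping; 19832 OPEN. [folklore]
-/

noncomputable section

set_option linter.dupNamespace false

open scoped RealInnerProductSpace

namespace Summit.NavierStokesRegularity.NavierStokesRegularity.Theorems.PowerGaugeEulerLiouville

namespace Spiral

/-! ## The pointwise algebra of the S-extras (limit passage of file 2) -/

/-- **The S-extra terms minus their limit are linear in `w − v`.** [folklore] -/
theorem spiralExtra_sub (x v w : EuclideanSpace ℝ (Fin 3)) (D S : EuclideanSpace ℝ (Fin 3) →L[ℝ] EuclideanSpace ℝ (Fin 3))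
    (d : EuclideanSpace ℝ (Fin 3) →L[ℝ] ℝ) (s : ℝ) :
    (d (S x) * ⟪v, w⟫ + s * ⟪v, D (S x)⟫ + s * ⟪S v, w⟫ - ((1 / 2 : ℝ) * (d (S x) * ‖w‖ ^ 2) + s * ⟪w, D (S x)⟫)) -
        ((1 / 2 : ℝ) * (d (S x) * ‖v‖ ^ 2) + s * ⟪S v, v⟫) =
      d (S x) * ⟪v, w - v⟫ - (1 / 2 : ℝ) * (d (S x) * ⟪w - v, w + v⟫) + s * ⟪v - w, D (S x)⟫ +
        s * ⟪S v, w - v⟫ := by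
  simp only [inner_sub_left, inner_sub_right, inner_add_right, ← real_inner_self_eq_norm_sq, real_inner_comm w v]
  ring

/-- **Pointwise bound for the S-extras**: `|Jₙ − J_∞| ≤ ((3/2·C'‖S‖R + C‖S‖)‖v‖ + ½C'‖S‖R‖w‖ + C‖S‖R‖D‖)·‖w − v‖`
(`‖d‖ ≤ C'`, `|s| ≤ C`, `‖x‖ ≤ R`). [folklore] -/
theorem abs_spiralExtra_sub_le {x v w : EuclideanSpace ℝ (Fin 3)} {D S : EuclideanSpace ℝ (Fin 3) →L[ℝ] EuclideanSpace ℝ (Fin 3)}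
    {d : EuclideanSpace ℝ (Fin 3) →L[ℝ] ℝ} {s C C' R : ℝ} (hd : ‖d‖ ≤ C') (hs : |s| ≤ C) (hx : ‖x‖ ≤ R) (hC : 0 ≤ C)
    (hC' : 0 ≤ C') (hR : 0 ≤ R) :
    |d (S x) * ⟪v, w - v⟫ - (1 / 2 : ℝ) * (d (S x) * ⟪w - v, w + v⟫) + s * ⟪v - w, D (S x)⟫ + s * ⟪S v, w - v⟫| ≤
      ((3 / 2 * C' * ‖S‖ * R + C * ‖S‖) * ‖v‖ + (1 / 2 * C' * ‖S‖ * R) * ‖w‖ + C * ‖S‖ * R * ‖D‖) * ‖w - v‖ := by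
  have hin : ∀ a b : EuclideanSpace ℝ (Fin 3), |⟪a, b⟫| ≤ ‖a‖ * ‖b‖ := fun a b => abs_real_inner_le_norm a b
  have hSx : ‖S x‖ ≤ ‖S‖ * R := (S.le_opNorm x).trans (mul_le_mul_of_nonneg_left hx (norm_nonneg _))
  have hdS : |d (S x)| ≤ C' * (‖S‖ * R) := by
    rw [← Real.norm_eq_abs]
    exact (d.le_opNorm _).trans (mul_le_mul hd hSx (norm_nonneg _) hC')
  have t1 : |d (S x) * ⟪v, w - v⟫| ≤ C' * (‖S‖ * R) * (‖v‖ * ‖w - v‖) := by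
    rw [abs_mul]
    exact mul_le_mul hdS (hin _ _) (abs_nonneg _) (by positivity)
  have t2 : |(1 / 2 : ℝ) * (d (S x) * ⟪w - v, w + v⟫)| ≤ (1 / 2 : ℝ) * (C' * (‖S‖ * R) * (‖w - v‖ * (‖w‖ + ‖v‖))) := by
    rw [abs_mul, abs_mul, abs_of_pos (by norm_num : (0 : ℝ) < 1 / 2)]
    refine mul_le_mul_of_nonneg_left (mul_le_mul hdS ((hin _ _).trans
      (mul_le_mul_of_nonneg_left (norm_add_le _ _) (norm_nonneg _))) (abs_nonneg _) (by positivity)) (by norm_num)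
  have t3 : |s * ⟪v - w, D (S x)⟫| ≤ C * (‖w - v‖ * (‖D‖ * (‖S‖ * R))) := by
    rw [abs_mul]
    refine mul_le_mul hs ?_ (abs_nonneg _) hC
    calc |⟪v - w, D (S x)⟫| ≤ ‖v - w‖ * ‖D (S x)‖ := hin _ _
      _ ≤ ‖w - v‖ * (‖D‖ * (‖S‖ * R)) := by
          rw [norm_sub_rev]
          exact mul_le_mul_of_nonneg_left ((D.le_opNorm _).trans (mul_le_mul_of_nonneg_left hSx (norm_nonneg _)))
            (norm_nonneg _)
  have t4 : |s * ⟪S v, w - v⟫| ≤ C * (‖S‖ * ‖v‖ * ‖w - v‖) := by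
    rw [abs_mul]
    refine mul_le_mul hs ?_ (abs_nonneg _) hC
    exact (hin _ _).trans (mul_le_mul_of_nonneg_right (S.le_opNorm _) (norm_nonneg _))
  calc |d (S x) * ⟪v, w - v⟫ - (1 / 2 : ℝ) * (d (S x) * ⟪w - v, w + v⟫) + s * ⟪v - w, D (S x)⟫ + s * ⟪S v, w - v⟫|
      ≤ |d (S x) * ⟪v, w - v⟫| + |(1 / 2 : ℝ) * (d (S x) * ⟪w - v, w + v⟫)| + |s * ⟪v - w, D (S x)⟫| +
          |s * ⟪S v, w - v⟫| :=
        (abs_add_le _ _).trans (add_le_add ((abs_add_le _ _).trans (add_le_add (abs_sub _ _) le_rfl)) le_rfl)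
    _ ≤ C' * (‖S‖ * R) * (‖v‖ * ‖w - v‖) + (1 / 2 : ℝ) * (C' * (‖S‖ * R) * (‖w - v‖ * (‖w‖ + ‖v‖))) +
          C * (‖w - v‖ * (‖D‖ * (‖S‖ * R))) + C * (‖S‖ * ‖v‖ * ‖w - v‖) := by linarith
    _ = ((3 / 2 * C' * ‖S‖ * R + C * ‖S‖) * ‖v‖ + (1 / 2 * C' * ‖S‖ * R) * ‖w‖ + C * ‖S‖ * R * ‖D‖) * ‖w - v‖ := by
        ring

/-! ## Bookkeeping: splitting the spiral integrands -/

/-- `(Iₙ + Jₙ) − (I_∞ + J_∞) = (Iₙ − I_∞) + (Jₙ − J_∞)` for the explicit integrands (atoms as in `ProfileEnergy.integrandN_sub_integrandLim`). [folklore] -/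
theorem integrandS_split (γ : ℝ) (x v w : EuclideanSpace ℝ (Fin 3))
    (D : EuclideanSpace ℝ (Fin 3) →L[ℝ] EuclideanSpace ℝ (Fin 3)) (d : EuclideanSpace ℝ (Fin 3) →L[ℝ] ℝ) (s p : ℝ)
    (S : EuclideanSpace ℝ (Fin 3) →L[ℝ] EuclideanSpace ℝ (Fin 3)) :
    (d v * ⟪v, w⟫ + s * ⟪v, D v⟫ + p * d w +
          γ * (d x * ⟪v, w⟫ + s * ⟪v, D x⟫) + (4 * γ - 1) * (s * ⟪v, w⟫) -
          ((1 / 2 : ℝ) * (d v * ‖w‖ ^ 2) + s * ⟪w, D v⟫) -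
          γ * ((1 / 2 : ℝ) * (d x * ‖w‖ ^ 2) + s * ⟪w, D x⟫ + 3 * ((1 / 2 : ℝ) * (s * ‖w‖ ^ 2))) +
          ((d (S x) * ⟪v, w⟫ + s * ⟪v, D (S x)⟫ + s * ⟪S v, w⟫) -
            ((1 / 2 : ℝ) * (d (S x) * ‖w‖ ^ 2) + s * ⟪w, D (S x)⟫))) -
        ((1 / 2 : ℝ) * (d v * ‖v‖ ^ 2) + p * d v + γ * ((1 / 2 : ℝ) * (d x * ‖v‖ ^ 2)) +
          (5 / 2 * γ - 1) * (s * ‖v‖ ^ 2) +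
          ((1 / 2 : ℝ) * (d (S x) * ‖v‖ ^ 2) + s * ⟪S v, v⟫)) =
      (d v * ⟪v, w⟫ + s * ⟪v, D v⟫ + p * d w +
          γ * (d x * ⟪v, w⟫ + s * ⟪v, D x⟫) + (4 * γ - 1) * (s * ⟪v, w⟫) -
          ((1 / 2 : ℝ) * (d v * ‖w‖ ^ 2) + s * ⟪w, D v⟫) -
          γ * ((1 / 2 : ℝ) * (d x * ‖w‖ ^ 2) + s * ⟪w, D x⟫ + 3 * ((1 / 2 : ℝ) * (s * ‖w‖ ^ 2))) -
          ((1 / 2 : ℝ) * (d v * ‖v‖ ^ 2) + p * d v + γ * ((1 / 2 : ℝ) * (d x * ‖v‖ ^ 2)) +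
            (5 / 2 * γ - 1) * (s * ‖v‖ ^ 2))) +
        ((d (S x) * ⟪v, w⟫ + s * ⟪v, D (S x)⟫ + s * ⟪S v, w⟫ - ((1 / 2 : ℝ) * (d (S x) * ‖w‖ ^ 2) + s * ⟪w, D (S x)⟫)) -
          ((1 / 2 : ℝ) * (d (S x) * ‖v‖ ^ 2) + s * ⟪S v, v⟫)) := by
  ring


end Spiral

end Summit.NavierStokesRegularity.NavierStokesRegularity.Theorems.PowerGaugeEulerLiouville
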